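import Summits.QuantumFields.YangMills.Theorems.FluctuationComparisonRegPrIntLS2BetaCornerSizeCover
import Summits.QuantumFields.YangMills.Theorems.FluctuationComparisonRegPrIntLS2BetaCurlBudgetOfChartTowerSup
import HarnessLib

/-!
# S2β · (SCT″-c)₁ (SRC-E)-core — «THE SOURCE-ROW ENERGY SPLITS»: with the ℓ²-CORNER size `M μ ν (i+1) y′ := √(Σ_{b ∈ corners} ‖X i b‖²)` (✓`…CornerSizeCover`), the fine-site
# source ROW energy `Bsrc` of ✓p838306∕✓p838904 is at most THREE named energies with explicit constants:
# `Bsrc(M) ≤ 3·Σ_i w(i+1)·L^{K−J−2−i}·(c̄(i+1)²·(4d²·Σ_{b : PBond (F.P K) i} ‖X i b‖²)) + 48·Σ_i w(i+1)·L^{K−J−2−i}·Σ_{μ,ν,y′} R² + 3·w(1)·L^{K−J−2}·Σ_{μ,ν,y′} junction₀²`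
# — i.e. `Bsrc ⟸` {(L2-TOWER)'s input `Σ_b ‖X i b‖²` with the CLASS coefficient `c̄(i+1)²` (BKG-decaying), the `R`-energy ((REG)-conditional), the level-1 junction energy ((SUP-DECAY)₀)}

Cell `ym3-torus` (YM ladder rung R3 = continuum `SU(2)` Yang–Mills on the three-torus at fixed lattice data — a RUNG: NOT d = 4, NOT infinite volume, NOT a mass gap,
NOT Clay).  Width seat «width 10» `ym3-torus-px10` (gen 26); crux `stmt-QuantumFields-20520`, LINE g18-1 S2β; px10's (SRC-E) SPEC (2026-09-01T00:49:48Z), pieces (0)+(ii).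
`--kind proof --supports stmt-QuantumFields-20520 --as helper`, count-neutral, DEFINITION-FREE (0 `def`, 0 `instance`, 0 `notation`, 0 `sorry`, default heartbeats).

WHAT IS PROVED (sorry-free).  (private `sq_add3_le`, three LIT twins exist — w8 g23 00:59:45Z); ★`srcM_eq_coeff_mul_add` (M-1‴'s `src` = `c_{μν}(i+1)·M + 4R` by `ring`); ★★★**`Bsrc_split_le`**: for the quaternionic chart tower `X`
(free here — any bond function), classes `α δ : ℕ → ℝ`, `αp` with a direction-uniform cap `αp μ ν i ≤ ᾱp i` and signs, the free remainder `R`, weights `w > 0`, and the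
ℓ²-corner size `M`: the displayed `Bsrc` text of ✓`linBudget_of_chartTower` (at this `M`) is `≤ 3·E_lin + 48·E_R + 3·E_J` with
`E_lin := Σ_{i<K−J} w(i+1)·L^{K−J−1−(i+1)}·(c̄(i+1)²·(4·d²·Σ_{b : PBond (F.P K) i} ‖X i b‖²))`, `c̄(i) := L·(L·(2δ(i)(L+2L+2))) + 48α(i)L + 2ᾱp(i)ℓ + 24α(i)ℓ + 4·404·ℓ·α(i) + 2δ(i)L²`,
`E_R := Σ_i w(i+1)·L^{…}·Σ_μΣ_νΣ_{y′} R μ ν (i+1) y′²`, `E_J := w(1)·L^{K−J−2}·Σ_μΣ_νΣ_{y′ : Site (F.P K) 1} (|Idx|⁻¹Σ_a rem(0, pos_a y′))²` (`K − J ≥ 1`; `0` else).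
USE: feed `hBsrc` of ✓p838904 `c1Budget_of_letters` with `M :=` the ℓ²-corner size (`hM′` := `Real.sqrt_nonneg`, `hXM` := ✓`le_sqrt_sum_sq_of_mem`) and `Bsrc := 3E_lin + 48E_R + 3E_J`;
then (L2-TOWER) (px12) + (BKG) class decay + weights `w_j := L^{K−J−1−j}` price `E_lin` as a purse-share (px10 SPEC count), (REG) prices `E_R`, (SUP-DECAY)₀ prices `E_J`.

HONEST SCOPE.  Real algebra over the displayed texts; nothing of Bałaban's renormalisation-group analysis is asserted or proved ([Balaban1985Averaging] Prop. 4 (128)–(135) pp.37–38;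
[Balaban1987RG1] (0.11) p.253); (L2-TOWER), class decay, (REG), (SUP-DECAY)₀ are NOT here; GAP♯∘ (`stub_uniformFibreGapOrbit`, registry 3732b7df UNTOUCHED, 0∕5), S2β, the five
registered stubs, crux 20520, 19936, 19200 and `YM3TorusSU2` are NOT proved; no registered stub is closed; rung R3 — NOT d = 4, NOT infinite volume, NOT a mass gap, NOT Clay;
the Yang–Mills mass gap is NOT proved.
-/

set_option autoImplicit false

noncomputable section

open scoped Matrix.Norms.L2Operator
open Finset

namespace Summit.QuantumFields.YangMills.Theorems.FluctuationComparisonRegPrIntLS2BetaSourceRowEnergySplit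

open Literature.MathematicalPhysics.QuantumFieldTheory.Balaban1983to89
open Literature.MathematicalPhysics.QuantumFieldTheory.Balaban1983to89.T4Continuum
open Literature.MathematicalPhysics.QuantumFieldTheory.Balaban1983to89.T3ContinuumYM3Torus
open Literature.MathematicalPhysics.QuantumFieldTheory.Balaban1983to89.HaarExponentialChart
open Literature.MathematicalPhysics.QuantumFieldTheory.Balaban1983to89.BlockAveraging (Idx)
open Literature.MathematicalPhysics.QuantumFieldTheory.Balaban1983to89.B10Eq47AxialChi (shiftN)
open Summit.QuantumFields.YangMills.Theorems.FluctuationComparisonRegPrIntLS2BetaCornerSizeCover (sum_sq_sqrtCorner_le le_sqrt_sum_sq_of_mem)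

/-- ★ `(a + b + c)² ≤ 3(a² + b² + c²)`. [folklore] -/
private theorem sq_add3_le (a b c : ℝ) : (a + b + c) ^ 2 ≤ 3 * (a ^ 2 + b ^ 2 + c ^ 2) := by
  nlinarith [sq_nonneg (a - b), sq_nonneg (b - c), sq_nonneg (a - c)]

variable (F : T3Family)

/-- ★★★ **THE SOURCE-ROW ENERGY SPLITS** (generic size letter `M ≥ 0` with a per-level ENERGY cap `EM i`) — see the module header.
[cite: Balaban1985Averaging, Prop. 4 (128)-(135) pp.37-38; Balaban1987RG1, (0.11) p.253] -/
theorem Bsrc_split_le {J K : ℕ}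
    (X : (i : ℕ) → PBond (F.P K) i → (specialUnitaryLogChart (Fin 2)).lie)
    (w : ℕ → ℝ) (hw : ∀ j, 0 < w j)
    (α δ : ℕ → ℝ) (αp : Fin (F.P K).d → Fin (F.P K).d → ℕ → ℝ) (αpb : ℕ → ℝ)
    (hα0 : ∀ i, 0 ≤ α i) (hδ0 : ∀ i, 0 ≤ δ i) (hαp0 : ∀ μ ν i, 0 ≤ αp μ ν i) (hαpb : ∀ μ ν i, αp μ ν i ≤ αpb i)
    (M : Fin (F.P K).d → Fin (F.P K).d → (i : ℕ) → Site (F.P K) i → ℝ)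
    (EM : ℕ → ℝ) (hEM : ∀ i, i < K - J → ∑ μ : Fin (F.P K).d, ∑ ν : Fin (F.P K).d, ∑ y' : Site (F.P K) (i + 1), M μ ν (i + 1) y' ^ 2 ≤ EM i)
    (R : Fin (F.P K).d → Fin (F.P K).d → (i : ℕ) → Site (F.P K) i → ℝ) :
    ∑ i ∈ Finset.range (K - J), w (i + 1) * (F.L : ℝ) ^ (K - J - 1 - (i + 1)) *
        ∑ μ : Fin (F.P K).d, ∑ ν : Fin (F.P K).d, ∑ y' : Site (F.P K) (i + 1),
          (if μ < ν then
          (((F.P K).L : ℝ) * (((F.P K).L : ℝ) * (2 * δ (i + 1) * (((F.P K).L : ℝ) + 2 * (F.P K).L + 2) * M μ ν (i + 1) y')) + 48 * α (i + 1) * (((F.P K).L : ℝ) * M μ ν (i + 1) y') +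
            (2 * αp μ ν (i + 1) * (((((F.P K).d + 2) * (F.P K).L : ℕ) : ℝ) * M μ ν (i + 1) y') + 24 * α (i + 1) * (((((F.P K).d + 2) * (F.P K).L : ℕ) : ℝ) * M μ ν (i + 1) y')) +
            4 * (404 * ((((F.P K).d + 2) * (F.P K).L : ℕ) : ℝ) * α (i + 1) * M μ ν (i + 1) y') + 4 * R μ ν (i + 1) y' +
            2 * δ (i + 1) * (((F.P K).L : ℝ) ^ 2 * M μ ν (i + 1) y')) +
          (if i = 0 then ((Fintype.card (Idx (F.P K)) : ℝ)⁻¹ *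
            ∑ a ∈ (Finset.univ : Finset (Idx (F.P K))) ×ˢ (Finset.range (F.P K).L ×ˢ Finset.range (F.P K).L),
              (Real.exp (‖X i ⟨(shiftN (shiftN (Site.blockSite y' a.1.1) μ a.2.1) ν a.2.2), μ⟩‖ + ‖X i ⟨((shiftN (shiftN (Site.blockSite y' a.1.1) μ a.2.1) ν a.2.2)).shift μ, ν⟩‖ + ‖X i ⟨((shiftN (shiftN (Site.blockSite y' a.1.1) μ a.2.1) ν a.2.2)).shift ν, μ⟩‖ + ‖X i ⟨(shiftN (shiftN (Site.blockSite y' a.1.1) μ a.2.1) ν a.2.2), ν⟩‖) - 1 - (‖X i ⟨(shiftN (shiftN (Site.blockSite y' a.1.1) μ a.2.1) ν a.2.2), μ⟩‖ + ‖X i ⟨((shiftN (shiftN (Site.blockSite y' a.1.1) μ a.2.1) ν a.2.2)).shift μ, ν⟩‖ + ‖X i ⟨((shiftN (shiftN (Site.blockSite y' a.1.1) μ a.2.1) ν a.2.2)).shift ν, μ⟩‖ + ‖X i ⟨(shiftN (shiftN (Site.blockSite y' a.1.1) μ a.2.1) ν a.2.2), ν⟩‖))) else 0)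
          else 0) ^ 2 ≤
      3 * ∑ i ∈ Finset.range (K - J), w (i + 1) * (F.L : ℝ) ^ (K - J - 1 - (i + 1)) *
          ((((F.P K).L : ℝ) * (((F.P K).L : ℝ) * (2 * δ (i + 1) * (((F.P K).L : ℝ) + 2 * (F.P K).L + 2))) + 48 * α (i + 1) * ((F.P K).L : ℝ) +
            (2 * αpb (i + 1) * ((((F.P K).d + 2) * (F.P K).L : ℕ) : ℝ) + 24 * α (i + 1) * ((((F.P K).d + 2) * (F.P K).L : ℕ) : ℝ)) +
            4 * (404 * ((((F.P K).d + 2) * (F.P K).L : ℕ) : ℝ) * α (i + 1)) + 2 * δ (i + 1) * ((F.P K).L : ℝ) ^ 2) ^ 2 * EM i) +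
      48 * ∑ i ∈ Finset.range (K - J), w (i + 1) * (F.L : ℝ) ^ (K - J - 1 - (i + 1)) *
          ∑ μ : Fin (F.P K).d, ∑ ν : Fin (F.P K).d, ∑ y' : Site (F.P K) (i + 1), R μ ν (i + 1) y' ^ 2 +
      3 * ∑ i ∈ Finset.range (K - J), w (i + 1) * (F.L : ℝ) ^ (K - J - 1 - (i + 1)) *
          ∑ μ : Fin (F.P K).d, ∑ ν : Fin (F.P K).d, ∑ y' : Site (F.P K) (i + 1),
            (if i = 0 then ((Fintype.card (Idx (F.P K)) : ℝ)⁻¹ *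
            ∑ a ∈ (Finset.univ : Finset (Idx (F.P K))) ×ˢ (Finset.range (F.P K).L ×ˢ Finset.range (F.P K).L),
              (Real.exp (‖X i ⟨(shiftN (shiftN (Site.blockSite y' a.1.1) μ a.2.1) ν a.2.2), μ⟩‖ + ‖X i ⟨((shiftN (shiftN (Site.blockSite y' a.1.1) μ a.2.1) ν a.2.2)).shift μ, ν⟩‖ + ‖X i ⟨((shiftN (shiftN (Site.blockSite y' a.1.1) μ a.2.1) ν a.2.2)).shift ν, μ⟩‖ + ‖X i ⟨(shiftN (shiftN (Site.blockSite y' a.1.1) μ a.2.1) ν a.2.2), ν⟩‖) - 1 - (‖X i ⟨(shiftN (shiftN (Site.blockSite y' a.1.1) μ a.2.1) ν a.2.2), μ⟩‖ + ‖X i ⟨((shiftN (shiftN (Site.blockSite y' a.1.1) μ a.2.1) ν a.2.2)).shift μ, ν⟩‖ + ‖X i ⟨((shiftN (shiftN (Site.blockSite y' a.1.1) μ a.2.1) ν a.2.2)).shift ν, μ⟩‖ + ‖X i ⟨(shiftN (shiftN (Site.blockSite y' a.1.1) μ a.2.1) ν a.2.2), ν⟩‖))) else 0) ^ 2 := by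
  have hL0 : (0 : ℝ) ≤ (F.L : ℝ) := Nat.cast_nonneg _
  have hℓ0 : (0 : ℝ) ≤ ((((F.P K).d + 2) * (F.P K).L : ℕ) : ℝ) := Nat.cast_nonneg _
  have hLK : (0 : ℝ) ≤ ((F.P K).L : ℝ) := Nat.cast_nonneg _
  rw [Finset.mul_sum, Finset.mul_sum, Finset.mul_sum, ← Finset.sum_add_distrib, ← Finset.sum_add_distrib]
  refine Finset.sum_le_sum fun i hi => ?_
  have hi' : i < K - J := Finset.mem_range.1 hi
  have hwi : 0 ≤ w (i + 1) * (F.L : ℝ) ^ (K - J - 1 - (i + 1)) := mul_nonneg (hw _).le (pow_nonneg hL0 _)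
  have hcoef0 : ∀ μ ν : Fin (F.P K).d, 0 ≤ (((F.P K).L : ℝ) * (((F.P K).L : ℝ) * (2 * δ (i + 1) * (((F.P K).L : ℝ) + 2 * (F.P K).L + 2))) + 48 * α (i + 1) * ((F.P K).L : ℝ) +
            (2 * αp μ ν (i + 1) * ((((F.P K).d + 2) * (F.P K).L : ℕ) : ℝ) + 24 * α (i + 1) * ((((F.P K).d + 2) * (F.P K).L : ℕ) : ℝ)) +
            4 * (404 * ((((F.P K).d + 2) * (F.P K).L : ℕ) : ℝ) * α (i + 1)) + 2 * δ (i + 1) * ((F.P K).L : ℝ) ^ 2) := by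
    intro μ ν
    have := hα0 (i + 1); have := hδ0 (i + 1); have := hαp0 μ ν (i + 1)
    positivity
  have hcoef : ∀ μ ν : Fin (F.P K).d, (((F.P K).L : ℝ) * (((F.P K).L : ℝ) * (2 * δ (i + 1) * (((F.P K).L : ℝ) + 2 * (F.P K).L + 2))) + 48 * α (i + 1) * ((F.P K).L : ℝ) +
            (2 * αp μ ν (i + 1) * ((((F.P K).d + 2) * (F.P K).L : ℕ) : ℝ) + 24 * α (i + 1) * ((((F.P K).d + 2) * (F.P K).L : ℕ) : ℝ)) +
            4 * (404 * ((((F.P K).d + 2) * (F.P K).L : ℕ) : ℝ) * α (i + 1)) + 2 * δ (i + 1) * ((F.P K).L : ℝ) ^ 2) ≤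
      (((F.P K).L : ℝ) * (((F.P K).L : ℝ) * (2 * δ (i + 1) * (((F.P K).L : ℝ) + 2 * (F.P K).L + 2))) + 48 * α (i + 1) * ((F.P K).L : ℝ) +
            (2 * αpb (i + 1) * ((((F.P K).d + 2) * (F.P K).L : ℕ) : ℝ) + 24 * α (i + 1) * ((((F.P K).d + 2) * (F.P K).L : ℕ) : ℝ)) +
            4 * (404 * ((((F.P K).d + 2) * (F.P K).L : ℕ) : ℝ) * α (i + 1)) + 2 * δ (i + 1) * ((F.P K).L : ℝ) ^ 2) := by
    intro μ ν
    have h1 := mul_le_mul_of_nonneg_right (hαpb μ ν (i + 1)) hℓ0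
    linarith
  -- pointwise split
  have hpt : ∀ (μ ν : Fin (F.P K).d) (y' : Site (F.P K) (i + 1)),
      (if μ < ν then
          (((F.P K).L : ℝ) * (((F.P K).L : ℝ) * (2 * δ (i + 1) * (((F.P K).L : ℝ) + 2 * (F.P K).L + 2) * M μ ν (i + 1) y')) + 48 * α (i + 1) * (((F.P K).L : ℝ) * M μ ν (i + 1) y') +
            (2 * αp μ ν (i + 1) * (((((F.P K).d + 2) * (F.P K).L : ℕ) : ℝ) * M μ ν (i + 1) y') + 24 * α (i + 1) * (((((F.P K).d + 2) * (F.P K).L : ℕ) : ℝ) * M μ ν (i + 1) y')) +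
            4 * (404 * ((((F.P K).d + 2) * (F.P K).L : ℕ) : ℝ) * α (i + 1) * M μ ν (i + 1) y') + 4 * R μ ν (i + 1) y' +
            2 * δ (i + 1) * (((F.P K).L : ℝ) ^ 2 * M μ ν (i + 1) y')) +
          (if i = 0 then ((Fintype.card (Idx (F.P K)) : ℝ)⁻¹ *
            ∑ a ∈ (Finset.univ : Finset (Idx (F.P K))) ×ˢ (Finset.range (F.P K).L ×ˢ Finset.range (F.P K).L),
              (Real.exp (‖X i ⟨(shiftN (shiftN (Site.blockSite y' a.1.1) μ a.2.1) ν a.2.2), μ⟩‖ + ‖X i ⟨((shiftN (shiftN (Site.blockSite y' a.1.1) μ a.2.1) ν a.2.2)).shift μ, ν⟩‖ + ‖X i ⟨((shiftN (shiftN (Site.blockSite y' a.1.1) μ a.2.1) ν a.2.2)).shift ν, μ⟩‖ + ‖X i ⟨(shiftN (shiftN (Site.blockSite y' a.1.1) μ a.2.1) ν a.2.2), ν⟩‖) - 1 - (‖X i ⟨(shiftN (shiftN (Site.blockSite y' a.1.1) μ a.2.1) ν a.2.2), μ⟩‖ + ‖X i ⟨((shiftN (shiftN (Site.blockSite y' a.1.1)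 μ a.2.1) ν a.2.2)).shift μ, ν⟩‖ + ‖X i ⟨((shiftN (shiftN (Site.blockSite y' a.1.1) μ a.2.1) ν a.2.2)).shift ν, μ⟩‖ + ‖X i ⟨(shiftN (shiftN (Site.blockSite y' a.1.1) μ a.2.1) ν a.2.2), ν⟩‖))) else 0)
          else 0) ^ 2 ≤
        3 * ((((F.P K).L : ℝ) * (((F.P K).L : ℝ) * (2 * δ (i + 1) * (((F.P K).L : ℝ) + 2 * (F.P K).L + 2))) + 48 * α (i + 1) * ((F.P K).L : ℝ) +
            (2 * αpb (i + 1) * ((((F.P K).d + 2) * (F.P K).L : ℕ) : ℝ) + 24 * α (i + 1) * ((((F.P K).d + 2) * (F.P K).L : ℕ) : ℝ)) +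
            4 * (404 * ((((F.P K).d + 2) * (F.P K).L : ℕ) : ℝ) * α (i + 1)) + 2 * δ (i + 1) * ((F.P K).L : ℝ) ^ 2) ^ 2 * M μ ν (i + 1) y' ^ 2) +
        48 * R μ ν (i + 1) y' ^ 2 + 3 * (if i = 0 then ((Fintype.card (Idx (F.P K)) : ℝ)⁻¹ *
            ∑ a ∈ (Finset.univ : Finset (Idx (F.P K))) ×ˢ (Finset.range (F.P K).L ×ˢ Finset.range (F.P K).L),
              (Real.exp (‖X i ⟨(shiftN (shiftN (Site.blockSite y' a.1.1) μ a.2.1) ν a.2.2), μ⟩‖ + ‖X i ⟨((shiftN (shiftN (Site.blockSite y' a.1.1) μ a.2.1) ν a.2.2)).shift μ, ν⟩‖ + ‖X i ⟨((shiftN (shiftN (Site.blockSite y' a.1.1) μ a.2.1) ν a.2.2)).shift ν, μ⟩‖ + ‖X i ⟨(shiftN (shiftN (Site.blockSite y' a.1.1) μ a.2.1) ν a.2.2), ν⟩‖) - 1 - (‖X i ⟨(shiftN (shiftN (Site.blockSite y' a.1.1) μ a.2.1) ν a.2.2), μ⟩‖ + ‖X i ⟨((shiftN (shiftN (Site.blockSite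 y' a.1.1) μ a.2.1) ν a.2.2)).shift μ, ν⟩‖ + ‖X i ⟨((shiftN (shiftN (Site.blockSite y' a.1.1) μ a.2.1) ν a.2.2)).shift ν, μ⟩‖ + ‖X i ⟨(shiftN (shiftN (Site.blockSite y' a.1.1) μ a.2.1) ν a.2.2), ν⟩‖))) else 0) ^ 2 := by
    intro μ ν y'
    have hsplit : (((F.P K).L : ℝ) * (((F.P K).L : ℝ) * (2 * δ (i + 1) * (((F.P K).L : ℝ) + 2 * (F.P K).L + 2) * M μ ν (i + 1) y')) + 48 * α (i + 1) * (((F.P K).L : ℝ) * M μ ν (i + 1) y') +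
            (2 * αp μ ν (i + 1) * (((((F.P K).d + 2) * (F.P K).L : ℕ) : ℝ) * M μ ν (i + 1) y') + 24 * α (i + 1) * (((((F.P K).d + 2) * (F.P K).L : ℕ) : ℝ) * M μ ν (i + 1) y')) +
            4 * (404 * ((((F.P K).d + 2) * (F.P K).L : ℕ) : ℝ) * α (i + 1) * M μ ν (i + 1) y') + 4 * R μ ν (i + 1) y' +
            2 * δ (i + 1) * (((F.P K).L : ℝ) ^ 2 * M μ ν (i + 1) y')) =
        (((F.P K).L : ℝ) * (((F.P K).L : ℝ) * (2 * δ (i + 1) * (((F.P K).L : ℝ) + 2 * (F.P K).L + 2))) + 48 * α (i + 1) * ((F.P K).L : ℝ) +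
            (2 * αp μ ν (i + 1) * ((((F.P K).d + 2) * (F.P K).L : ℕ) : ℝ) + 24 * α (i + 1) * ((((F.P K).d + 2) * (F.P K).L : ℕ) : ℝ)) +
            4 * (404 * ((((F.P K).d + 2) * (F.P K).L : ℕ) : ℝ) * α (i + 1)) + 2 * δ (i + 1) * ((F.P K).L : ℝ) ^ 2) * M μ ν (i + 1) y' + 4 * R μ ν (i + 1) y' := by ring
    have h3 := sq_add3_le ((((F.P K).L : ℝ) * (((F.P K).L : ℝ) * (2 * δ (i + 1) * (((F.P K).L : ℝ) + 2 * (F.P K).L + 2))) + 48 * α (i + 1) * ((F.P K).L : ℝ) +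
            (2 * αp μ ν (i + 1) * ((((F.P K).d + 2) * (F.P K).L : ℕ) : ℝ) + 24 * α (i + 1) * ((((F.P K).d + 2) * (F.P K).L : ℕ) : ℝ)) +
            4 * (404 * ((((F.P K).d + 2) * (F.P K).L : ℕ) : ℝ) * α (i + 1)) + 2 * δ (i + 1) * ((F.P K).L : ℝ) ^ 2) * M μ ν (i + 1) y') (4 * R μ ν (i + 1) y') (if i = 0 then ((Fintype.card (Idx (F.P K)) : ℝ)⁻¹ *
            ∑ a ∈ (Finset.univ : Finset (Idx (F.P K))) ×ˢ (Finset.range (F.P K).L ×ˢ Finset.range (F.P K).L),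
              (Real.exp (‖X i ⟨(shiftN (shiftN (Site.blockSite y' a.1.1) μ a.2.1) ν a.2.2), μ⟩‖ + ‖X i ⟨((shiftN (shiftN (Site.blockSite y' a.1.1) μ a.2.1) ν a.2.2)).shift μ, ν⟩‖ + ‖X i ⟨((shiftN (shiftN (Site.blockSite y' a.1.1) μ a.2.1) ν a.2.2)).shift ν, μ⟩‖ + ‖X i ⟨(shiftN (shiftN (Site.blockSite y' a.1.1) μ a.2.1) ν a.2.2), ν⟩‖) - 1 - (‖X i ⟨(shiftN (shiftN (Site.blockSite y' a.1.1) μ a.2.1) ν a.2.2), μ⟩‖ + ‖X i ⟨((shiftN (shiftN (Site.blockSite y' a.1.1) μ a.2.1) ν a.2.2)).shift μ, ν⟩‖ + ‖X i ⟨((shiftN (shiftN (Site.blockSite y' a.1.1) μ a.2.1) ν a.2.2)).shift ν, μ⟩‖ + ‖X i ⟨(shiftN (shiftN (Site.blockSite y' a.1.1) μ a.2.1) ν a.2.2), ν⟩‖))) else 0)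
    have hcm : ((((F.P K).L : ℝ) * (((F.P K).L : ℝ) * (2 * δ (i + 1) * (((F.P K).L : ℝ) + 2 * (F.P K).L + 2))) + 48 * α (i + 1) * ((F.P K).L : ℝ) +
            (2 * αp μ ν (i + 1) * ((((F.P K).d + 2) * (F.P K).L : ℕ) : ℝ) + 24 * α (i + 1) * ((((F.P K).d + 2) * (F.P K).L : ℕ) : ℝ)) +
            4 * (404 * ((((F.P K).d + 2) * (F.P K).L : ℕ) : ℝ) * α (i + 1)) + 2 * δ (i + 1) * ((F.P K).L : ℝ) ^ 2) * M μ ν (i + 1) y') ^ 2 ≤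
        (((F.P K).L : ℝ) * (((F.P K).L : ℝ) * (2 * δ (i + 1) * (((F.P K).L : ℝ) + 2 * (F.P K).L + 2))) + 48 * α (i + 1) * ((F.P K).L : ℝ) +
            (2 * αpb (i + 1) * ((((F.P K).d + 2) * (F.P K).L : ℕ) : ℝ) + 24 * α (i + 1) * ((((F.P K).d + 2) * (F.P K).L : ℕ) : ℝ)) +
            4 * (404 * ((((F.P K).d + 2) * (F.P K).L : ℕ) : ℝ) * α (i + 1)) + 2 * δ (i + 1) * ((F.P K).L : ℝ) ^ 2) ^ 2 * M μ ν (i + 1) y' ^ 2 := by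
      rw [mul_pow]
      exact mul_le_mul_of_nonneg_right (pow_le_pow_left₀ (hcoef0 μ ν) (hcoef μ ν) 2) (sq_nonneg _)
    have h16 : (4 * R μ ν (i + 1) y') ^ 2 = 16 * R μ ν (i + 1) y' ^ 2 := by ring
    by_cases hμν : μ < ν
    · rw [if_pos hμν, hsplit]
      rw [h16] at h3
      linarith [hcm, h3]
    · rw [if_neg hμν]
      have : (0 : ℝ) ^ 2 = 0 := by norm_num
      rw [this]
      positivity
  have hsum := Finset.sum_le_sum fun μ (_ : μ ∈ (Finset.univ : Finset (Fin (F.P K).d))) =>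
    Finset.sum_le_sum fun ν (_ : ν ∈ (Finset.univ : Finset (Fin (F.P K).d))) =>
      Finset.sum_le_sum fun y' (_ : y' ∈ (Finset.univ : Finset (Site (F.P K) (i + 1)))) => hpt μ ν y'
  have hC2 : 0 ≤ (((F.P K).L : ℝ) * (((F.P K).L : ℝ) * (2 * δ (i + 1) * (((F.P K).L : ℝ) + 2 * (F.P K).L + 2))) + 48 * α (i + 1) * ((F.P K).L : ℝ) +
            (2 * αpb (i + 1) * ((((F.P K).d + 2) * (F.P K).L : ℕ) : ℝ) + 24 * α (i + 1) * ((((F.P K).d + 2) * (F.P K).L : ℕ) : ℝ)) +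
            4 * (404 * ((((F.P K).d + 2) * (F.P K).L : ℕ) : ℝ) * α (i + 1)) + 2 * δ (i + 1) * ((F.P K).L : ℝ) ^ 2) ^ 2 := sq_nonneg _
  have hlev : ∑ μ : Fin (F.P K).d, ∑ ν : Fin (F.P K).d, ∑ y' : Site (F.P K) (i + 1),
      (if μ < ν then
          (((F.P K).L : ℝ) * (((F.P K).L : ℝ) * (2 * δ (i + 1) * (((F.P K).L : ℝ) + 2 * (F.P K).L + 2) * M μ ν (i + 1) y')) + 48 * α (i + 1) * (((F.P K).L : ℝ) * M μ ν (i + 1) y') +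
            (2 * αp μ ν (i + 1) * (((((F.P K).d + 2) * (F.P K).L : ℕ) : ℝ) * M μ ν (i + 1) y') + 24 * α (i + 1) * (((((F.P K).d + 2) * (F.P K).L : ℕ) : ℝ) * M μ ν (i + 1) y')) +
            4 * (404 * ((((F.P K).d + 2) * (F.P K).L : ℕ) : ℝ) * α (i + 1) * M μ ν (i + 1) y') + 4 * R μ ν (i + 1) y' +
            2 * δ (i + 1) * (((F.P K).L : ℝ) ^ 2 * M μ ν (i + 1) y')) +
          (if i = 0 then ((Fintype.card (Idx (F.P K)) : ℝ)⁻¹ *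
            ∑ a ∈ (Finset.univ : Finset (Idx (F.P K))) ×ˢ (Finset.range (F.P K).L ×ˢ Finset.range (F.P K).L),
              (Real.exp (‖X i ⟨(shiftN (shiftN (Site.blockSite y' a.1.1) μ a.2.1) ν a.2.2), μ⟩‖ + ‖X i ⟨((shiftN (shiftN (Site.blockSite y' a.1.1) μ a.2.1) ν a.2.2)).shift μ, ν⟩‖ + ‖X i ⟨((shiftN (shiftN (Site.blockSite y' a.1.1) μ a.2.1) ν a.2.2)).shift ν, μ⟩‖ + ‖X i ⟨(shiftN (shiftN (Site.blockSite y' a.1.1) μ a.2.1) ν a.2.2), ν⟩‖) - 1 - (‖X i ⟨(shiftN (shiftN (Site.blockSite y' a.1.1) μ a.2.1) ν a.2.2), μ⟩‖ + ‖X i ⟨((shiftN (shiftN (Site.blockSite y' a.1.1) μ a.2.1) ν a.2.2)).shift μ, ν⟩‖ + ‖X i ⟨((shiftN (shiftN (Site.blockSite y' a.1.1) μ a.2.1) ν a.2.2)).shift ν, μ⟩‖ + ‖X i ⟨(shiftN (shiftN (Site.blockSite y' a.1.1) μ a.2.1) ν a.2.2), ν⟩‖))) else 0)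
          else 0) ^ 2 ≤
      3 * ((((F.P K).L : ℝ) * (((F.P K).L : ℝ) * (2 * δ (i + 1) * (((F.P K).L : ℝ) + 2 * (F.P K).L + 2))) + 48 * α (i + 1) * ((F.P K).L : ℝ) +
            (2 * αpb (i + 1) * ((((F.P K).d + 2) * (F.P K).L : ℕ) : ℝ) + 24 * α (i + 1) * ((((F.P K).d + 2) * (F.P K).L : ℕ) : ℝ)) +
            4 * (404 * ((((F.P K).d + 2) * (F.P K).L : ℕ) : ℝ) * α (i + 1)) + 2 * δ (i + 1) * ((F.P K).L : ℝ) ^ 2) ^ 2 * EM i) +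
      48 * ∑ μ : Fin (F.P K).d, ∑ ν : Fin (F.P K).d, ∑ y' : Site (F.P K) (i + 1), R μ ν (i + 1) y' ^ 2 +
      3 * ∑ μ : Fin (F.P K).d, ∑ ν : Fin (F.P K).d, ∑ y' : Site (F.P K) (i + 1), (if i = 0 then ((Fintype.card (Idx (F.P K)) : ℝ)⁻¹ *
            ∑ a ∈ (Finset.univ : Finset (Idx (F.P K))) ×ˢ (Finset.range (F.P K).L ×ˢ Finset.range (F.P K).L),
              (Real.exp (‖X i ⟨(shiftN (shiftN (Site.blockSite y' a.1.1) μ a.2.1) ν a.2.2), μ⟩‖ + ‖X i ⟨((shiftN (shiftN (Site.blockSite y' a.1.1) μ a.2.1) ν a.2.2)).shift μ, ν⟩‖ + ‖X i ⟨((shiftN (shiftN (Site.blockSite y' a.1.1) μ a.2.1) ν a.2.2)).shift ν, μ⟩‖ + ‖X i ⟨(shiftN (shiftN (Site.blockSite y' a.1.1) μ a.2.1) ν a.2.2), ν⟩‖) - 1 - (‖X i ⟨(shiftN (shiftN (Site.blockSite y' a.1.1) μ a.2.1) ν a.2.2), μ⟩‖ + ‖X i ⟨((shiftN (shiftN (Site.blockSite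 y' a.1.1) μ a.2.1) ν a.2.2)).shift μ, ν⟩‖ + ‖X i ⟨((shiftN (shiftN (Site.blockSite y' a.1.1) μ a.2.1) ν a.2.2)).shift ν, μ⟩‖ + ‖X i ⟨(shiftN (shiftN (Site.blockSite y' a.1.1) μ a.2.1) ν a.2.2), ν⟩‖))) else 0) ^ 2 := by
    refine hsum.trans ?_
    simp only [Finset.sum_add_distrib, ← Finset.mul_sum]
    have := mul_le_mul_of_nonneg_left (hEM i hi') (mul_nonneg (by norm_num : (0:ℝ) ≤ 3) hC2)
    linarith [this]
  have := mul_le_mul_of_nonneg_left hlev hwi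
  linarith [this]

/-! ## The ℓ²-corner size as the size letter -/

/-- ★ The ℓ²-corner size is nonnegative. [folklore] -/
theorem cornerM_nonneg {K : ℕ} (X : (i : ℕ) → PBond (F.P K) i → (specialUnitaryLogChart (Fin 2)).lie) :
    ∀ (μ ν : Fin (F.P K).d) (i : ℕ) (x : Site (F.P K) i), (0 : ℝ) ≤ (fun (μ ν : Fin (F.P K).d) (i : ℕ) =>
      match i with
        | 0 => fun (_ : Site (F.P K) 0) => (0 : ℝ)
        | i' + 1 => fun (y' : Site (F.P K) (i' + 1)) => Real.sqrt (∑ b ∈ (univ.filter (fun b : PBond (F.P K) i' => blockOf b.src = y' ∨ blockOf b.src = y'.shift μ ∨ blockOf b.src = y'.shift ν ∨ blockOf b.src = (y'.shift μ).shift ν)), ‖X i' b‖ ^ 2)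
      : Fin (F.P K).d → Fin (F.P K).d → (i : ℕ) → Site (F.P K) i → ℝ) μ ν i x := by
  intro μ ν i x
  cases i with
  | zero => exact le_rfl
  | succ i' => exact Real.sqrt_nonneg _

/-- ★★ The ℓ²-corner size DOMINATES every corner bond (✓`linBudget_of_chartTower`'s `hXM` binder shape). [cite: Balaban1985Averaging, Prop. 4 (128)-(135) pp.37-38] -/
theorem cornerM_dominates {J K : ℕ} (X : (i : ℕ) → PBond (F.P K) i → (specialUnitaryLogChart (Fin 2)).lie) :
    ∀ μ ν : Fin (F.P K).d, μ < ν → ∀ i, i < K - J → ∀ (y' : Site (F.P K) (i + 1)) (b : PBond (F.P K) i),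
      (blockOf b.src = y' ∨ blockOf b.src = y'.shift μ ∨ blockOf b.src = y'.shift ν ∨ blockOf b.src = (y'.shift μ).shift ν) →
        ‖X i b‖ ≤ (fun (μ ν : Fin (F.P K).d) (i : ℕ) =>
      match i with
        | 0 => fun (_ : Site (F.P K) 0) => (0 : ℝ)
        | i' + 1 => fun (y' : Site (F.P K) (i' + 1)) => Real.sqrt (∑ b ∈ (univ.filter (fun b : PBond (F.P K) i' => blockOf b.src = y' ∨ blockOf b.src = y'.shift μ ∨ blockOf b.src = y'.shift ν ∨ blockOf b.src = (y'.shift μ).shift ν)), ‖X i' b‖ ^ 2)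
      : Fin (F.P K).d → Fin (F.P K).d → (i : ℕ) → Site (F.P K) i → ℝ) μ ν (i + 1) y' := by
  intro μ ν _ i _ y' b hb
  show ‖X i b‖ ≤ Real.sqrt (∑ b ∈ (univ.filter (fun b : PBond (F.P K) i => blockOf b.src = y' ∨ blockOf b.src = y'.shift μ ∨ blockOf b.src = y'.shift ν ∨ blockOf b.src = (y'.shift μ).shift ν)), ‖X i b‖ ^ 2)
  exact le_sqrt_sum_sq_of_mem (fun b => ‖X i b‖) (fun _ => norm_nonneg _) (Finset.mem_filter.2 ⟨Finset.mem_univ _, hb⟩)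

/-- ★★ The ℓ²-corner size's per-level ENERGY cap: `EM i := 4·d²·Σ_b ‖X i b‖²`. [cite: Balaban1985Averaging, (2) p.17] -/
theorem cornerM_energy {K : ℕ} (X : (i : ℕ) → PBond (F.P K) i → (specialUnitaryLogChart (Fin 2)).lie) (i : ℕ) :
    ∑ μ : Fin (F.P K).d, ∑ ν : Fin (F.P K).d, ∑ y' : Site (F.P K) (i + 1), ((fun (μ ν : Fin (F.P K).d) (i : ℕ) =>
      match i with
        | 0 => fun (_ : Site (F.P K) 0) => (0 : ℝ)
        | i' + 1 => fun (y' : Site (F.P K) (i' + 1)) => Real.sqrt (∑ b ∈ (univ.filter (fun b : PBond (F.P K) i' => blockOf b.src = y' ∨ blockOf b.src = y'.shift μ ∨ blockOf b.src = y'.shift ν ∨ blockOf b.src = (y'.shift μ).shift ν)), ‖X i' b‖ ^ 2)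
      : Fin (F.P K).d → Fin (F.P K).d → (i : ℕ) → Site (F.P K) i → ℝ) μ ν (i + 1) y') ^ 2 ≤
      4 * ((F.P K).d : ℝ) ^ 2 * ∑ b : PBond (F.P K) i, ‖X i b‖ ^ 2 :=
  sum_sq_sqrtCorner_le (P := F.P K) (k := i) (fun b => ‖X i b‖)

end Summit.QuantumFields.YangMills.Theorems.FluctuationComparisonRegPrIntLS2BetaSourceRowEnergySplit

end
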